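import Summits.QuantumFields.YangMills.Theorems.BalabanUVNodesN21ShellSplitOfRecord13CoPHChartKeyed

/-!
# N21 (NE7c) · A6 CERTIFICATE FOR THE CHART ROAD: at a block holding EVERY bond of some site, the window letter `hlaw` and the (printed)
# gauge invariance of the dressed fibre density are JOINTLY inhabited only by the ZERO fibre law — Haar averaging over the interior gauge move

Track A of `YM-PLAN.md` (cell `pub-ymgap`, HUMAN RULING D-0062 ∕ D-0149 width seats), node **N21**; WIDTH SEAT `pub-ymgap-dag-n21-w2` (gen 2), file 17 = the KERNEL
CERTIFICATE behind the seat's LOCATED-1 line (bus, 06:58Z).  THEOREMS ONLY: 0 `def`, 0 `sorry`; COUNT-NEUTRAL; `--kind proof --supports stmt-QuantumFields-20544 --as helper`.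
Imports my socket `…ChartKeyed` (p605800; brings dag-n21-d's Defs `blockFibreLawOfDatum₉` ∕ `cubeDensityOfDatum₉`, pub-balaban's `windowSU` ∕ `expWindowSU`, `blockLaw`).  NO Theses import.

THE FINDING (director-ym A6 №189 (3) genre: «are the displayed binders jointly inhabited beyond the junk case?»).  The chart road (junction №3 p600281, socket p605800,
guarded face p608096, leaf p609777, literal knit p610468) asks per fibre the WINDOW FACTORISATION `hlaw`: the block fibre law of record `(∏ Haar).withDensity (y ↦ density (x ⊕ y))`
equals `(blockLaw b).withDensity (windowSU b c S · R)` — so the fibre density VANISHES a.e. as soon as ONE block bond leaves its window `c(b')·exp(B̄_S)` about a FIXED centre.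
If the block `b` holds every bond at some site `z`, the gauge transformation at `z` moves ONLY block bonds (`y(b') ↦ g·y(b')` out of `z`, `y(b') ↦ y(b')·g⁻¹` into `z`), print makes
the dressed density invariant under it ([RG-I] p.263; [III] (2.16)–(2.17) — a LETTER here), and averaging over `g` (Haar, right invariant) shows `Haar{density ≠ 0} ≤ (1 − q)·Haar{density
≠ 0}` with `1 − q = Haar(one-bond window) < 1` ⇒ the density is `0` a.e.

WHAT IS PROVED ([folklore] measure theory: Tonelli + measure preservation; everything stated for an ABSTRACT move, then for a product of groups, then for dag-n21-d's fibre law).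
* §1 ★ `measure_support_eq_zero_of_invariant_of_escape` — on an s-finite measure space `(Ω, μ)` with a measurable family of `μ`-preserving maps `τ g` indexed by a probability
  space `(G, η)`: a measurable set `A` invariant under every `τ g`, a.e. contained in a measurable `W`, whose every orbit spends at most `q < 1` of its `η`-time in `W`
  (`η {g | τ g x ∈ W} ≤ q` for all `x`), and of finite measure, is NULL; ★ `density_ae_zero_of_invariant_of_window` — the same for the support `{D ≠ 0}` of a measurable
  invariant density vanishing a.e. off `W`; `ae_zero_off_of_withDensity_eq_indicator_mul` — «`μ.withDensity D = μ.withDensity (W.indicator 1 * R)` ⇒ `D = 0` a.e. off `W`».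
* §2 THE SITE MOVE ON A PRODUCT OF GROUPS (`Ω = ι → G'`, `μ = ∏ Haar`, `HaarData G'`): `siteMove O I g y i = g·y i` on `O`, `y i·g⁻¹` on `I ∖ O`, `y i` elsewhere — stated INLINE
  (no `def`): `measurePreserving_siteMove` (`measurePreserving_pi` + `HaarData.map_mul_left ∕ map_mul_right ∕ map_inv`) · `measurable_siteMove_uncurry` · `haar_escape_le`
  (for `i₀ ∈ O` and a product window: `Haar{g | move g y ∈ ∏ win} ≤ Haar (win i₀)`, right invariance) · ★★ `pi_density_ae_zero_of_siteInvariant_of_window`.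
* §3 AT dag-n21-d's BLOCK FIBRE LAW: ★★ `blockFibreLawOfDatum₉_eq_zero_of_window_of_siteInvariant` — `hlaw` (any `S`, any centre `c`, any `R`) + invariance of
  `y ↦ cubeDensityOfDatum₉ … (x ⊕ y)` under the site move at a nonempty set `O ⊆ b` of out-bonds and a set `I ⊆ b` of in-bonds (the LETTER: printed gauge invariance at a site
  all of whose bonds lie in `b`) + ONE out-bond `b₀ ∈ O` whose window has Haar mass `< 1` (LETTER: folklore — `exp(B̄_π)` misses every element with eigenvalue `−1`, pub-balaban
  `abs_eigen_lt_pi`; displayed, not proved here, because the tree's `HaarData` is an abstract invariant probability) ⟹ `blockFibreLawOfDatum₉ … t a b x = 0`;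
  `slotAntiConcentration_of_measure_eq_zero` — and then (M1) holds for EVERY `θ ρ D` (the junk inhabitation, said plainly).
REPAIR (bus LOCATED-1, not typed here): disintegrate along `inputBlock a ∖ (maximal tree)` (dag-n21-d FILE 5 is generic in `b`; no site is then interior) or tree-gauge the cube law first
(pub-balaban `ShellMeasureScalingLocal.slotAntiConcentration_gaugeFixed_iff`).

HONEST FRAMING.  A certificate about MY OWN road's letters; the gauge invariance of the dressed density and the window-mass row are HYPOTHESES (printed ∕ folklore, located);
nothing of Bałaban's asserted as proved; NE7c NOT PRINTED ∕ NOT proved; **N21 NOT discharged**; K3⁷ NOT claimed; counts UNMOVED (typed 28∕28 · discharged 5∕27); one finite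
four-torus programme at fixed `ε` — NOT ℝ⁴, NOT infinite volume, NOT OS, NOT a mass gap, NOT Clay.  No decl below carries a cite tag.
-/

set_option autoImplicit false

noncomputable section

open scoped BigOperators ENNReal
open MeasureTheory Set Function

namespace Summit.QuantumFields.YangMills.Theorems.N21ChartJunctionKeyed

/-! ## §1 Abstract: an invariant set whose orbits escape a window is null -/

section Abstract

variable {Ω G : Type*} [MeasurableSpace Ω] [MeasurableSpace G]

/-- ★ **AN INVARIANT SET WHOSE ORBITS ESCAPE THE WINDOW IS NULL.**  `μ` s-finite, `η` a probability; `τ g` a jointly measurable family of `μ`-preserving maps; `A`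
measurable, `τ g`-invariant, of finite measure, a.e. inside a measurable `W`; every orbit `g ↦ τ g x` spends `η`-mass `≤ q < 1` in `W`.  Then `μ A = 0`
(Tonelli: `μ A = μ (A ∩ W) = ∫∫ 1_{A∩W}(τ g x) ≤ ∫ 1_A(x)·η{g | τ g x ∈ W} ≤ q·μ A`). [folklore] -/
theorem measure_eq_zero_of_invariant_of_escape (μ : Measure Ω) [SFinite μ] (η : Measure G) [IsProbabilityMeasure η]
    (τ : G → Ω → Ω) (hτm : Measurable fun p : G × Ω => τ p.1 p.2) (hτ : ∀ g, MeasurePreserving (τ g) μ μ)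
    {A W : Set Ω} (hA : MeasurableSet A) (hW : MeasurableSet W) (hinv : ∀ g x, τ g x ∈ A ↔ x ∈ A)
    (hAW : μ (A \ W) = 0) {q : ℝ≥0∞} (hq : q < 1) (hesc : ∀ x, η {g | τ g x ∈ W} ≤ q) (hfin : μ A ≠ ∞) :
    μ A = 0 := by
  have hτg : ∀ g, Measurable (τ g) := fun g => (hτ g).measurable
  have hτx : ∀ x, Measurable fun g => τ g x := fun x => hτm.comp (measurable_id.prodMk measurable_const)
  have hAWm : MeasurableSet (A ∩ W) := hA.inter hW
  -- μ A = μ (A ∩ W)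
  have hAeq : μ A = μ (A ∩ W) := by
    have : μ A = μ (A ∩ W) + μ (A \ W) := (measure_inter_add_sdiff A hW).symm
    rw [this, hAW, add_zero]
  -- for every g: μ (A ∩ W) = ∫⁻ x, 1_{A∩W} (τ g x) ∂μ
  have hstep : ∀ g, μ (A ∩ W) = ∫⁻ x, (A ∩ W).indicator (1 : Ω → ℝ≥0∞) (τ g x) ∂μ := fun g => by
    have h1 : ∫⁻ x, (A ∩ W).indicator (1 : Ω → ℝ≥0∞) (τ g x) ∂μ = ∫⁻ y, (A ∩ W).indicator (1 : Ω → ℝ≥0∞) y ∂(μ.map (τ g)) :=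
      (lintegral_map (measurable_one.indicator hAWm) (hτg g)).symm
    rw [h1, (hτ g).map_eq, lintegral_indicator_one hAWm]
  -- integrate over g and swap
  have hjoint : Measurable fun p : G × Ω => (A ∩ W).indicator (1 : Ω → ℝ≥0∞) (τ p.1 p.2) :=
    (measurable_one.indicator hAWm).comp hτm
  have hint : μ (A ∩ W) = ∫⁻ x, ∫⁻ g, (A ∩ W).indicator (1 : Ω → ℝ≥0∞) (τ g x) ∂η ∂μ := by
    calc μ (A ∩ W) = ∫⁻ _g, μ (A ∩ W) ∂η := by rw [lintegral_const, measure_univ, mul_one]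
      _ = ∫⁻ g, ∫⁻ x, (A ∩ W).indicator (1 : Ω → ℝ≥0∞) (τ g x) ∂μ ∂η := lintegral_congr fun g => hstep g
      _ = ∫⁻ x, ∫⁻ g, (A ∩ W).indicator (1 : Ω → ℝ≥0∞) (τ g x) ∂η ∂μ := lintegral_lintegral_swap hjoint.aemeasurable
  -- pointwise: 1_{A∩W}(τ g x) = 1_A(x) · 1_{g | τ g x ∈ W}
  have hpt : ∀ x, ∫⁻ g, (A ∩ W).indicator (1 : Ω → ℝ≥0∞) (τ g x) ∂η ≤ A.indicator (1 : Ω → ℝ≥0∞) x * q := fun x => by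
    by_cases hx : x ∈ A
    · rw [indicator_of_mem hx, Pi.one_apply, one_mul]
      calc ∫⁻ g, (A ∩ W).indicator (1 : Ω → ℝ≥0∞) (τ g x) ∂η
          ≤ ∫⁻ g, {g | τ g x ∈ W}.indicator (1 : G → ℝ≥0∞) g ∂η := by
            refine lintegral_mono fun g => ?_
            by_cases hg : τ g x ∈ W
            · by_cases hg' : τ g x ∈ A ∩ W
              · rw [indicator_of_mem hg', indicator_of_mem (show g ∈ {g | τ g x ∈ W} from hg)]
                simp only [Pi.one_apply, le_refl]
              · rw [indicator_of_notMem hg']; exact zero_le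
            · have : τ g x ∉ A ∩ W := fun h => hg h.2
              rw [indicator_of_notMem this]; exact zero_le
        _ = η {g | τ g x ∈ W} := lintegral_indicator_one ((hτx x) hW)
        _ ≤ q := hesc x
    · have h0 : ∀ g, (A ∩ W).indicator (1 : Ω → ℝ≥0∞) (τ g x) = 0 := fun g => by
        have : τ g x ∉ A ∩ W := fun h => hx ((hinv g x).1 h.1)
        rw [indicator_of_notMem this]
      simp [h0, hx]
  -- hence μ A ≤ q * μ A
  have hle : μ A ≤ q * μ A := by
    calc μ A = μ (A ∩ W) := hAeq
      _ = ∫⁻ x, ∫⁻ g, (A ∩ W).indicator (1 : Ω → ℝ≥0∞) (τ g x) ∂η ∂μ := hint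
      _ ≤ ∫⁻ x, A.indicator (1 : Ω → ℝ≥0∞) x * q ∂μ := lintegral_mono hpt
      _ = q * μ A := by
        rw [lintegral_mul_const _ (measurable_one.indicator hA), lintegral_indicator_one hA, mul_comm]
  by_contra hne
  have hlt : q * μ A < 1 * μ A := ENNReal.mul_lt_mul_left hne hfin hq
  rw [one_mul] at hlt
  exact absurd hle (not_le.mpr hlt)

/-- ★ **AN INVARIANT DENSITY VANISHING OFF A WINDOW ITS ORBITS ESCAPE IS ZERO A.E.** — §1's set form at `A := {D ≠ 0}`. [folklore] -/
theorem density_ae_zero_of_invariant_of_window (μ : Measure Ω) [SFinite μ] (η : Measure G) [IsProbabilityMeasure η]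
    (τ : G → Ω → Ω) (hτm : Measurable fun p : G × Ω => τ p.1 p.2) (hτ : ∀ g, MeasurePreserving (τ g) μ μ)
    {D : Ω → ℝ≥0∞} (hD : Measurable D) (hinv : ∀ g x, D (τ g x) = D x)
    {W : Set Ω} (hW : MeasurableSet W) (hDW : ∀ᵐ x ∂μ, x ∉ W → D x = 0)
    {q : ℝ≥0∞} (hq : q < 1) (hesc : ∀ x, η {g | τ g x ∈ W} ≤ q) (hfin : μ {x | D x ≠ 0} ≠ ∞) :
    D =ᵐ[μ] 0 := by
  have hA : MeasurableSet {x | D x ≠ 0} := hD (measurableSet_singleton 0).compl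
  have hAW : μ ({x | D x ≠ 0} \ W) = 0 := by
    refine measure_eq_zero_iff_ae_notMem.mpr ?_
    filter_upwards [hDW] with x hx hmem
    exact hmem.1 (hx hmem.2)
  have h0 := measure_eq_zero_of_invariant_of_escape μ η τ hτm hτ hA hW
    (fun g x => by simp only [mem_setOf_eq, hinv g x]) hAW hq hesc hfin
  rw [Filter.EventuallyEq, ae_iff]
  simpa using h0

/-- «`μ.withDensity D = μ.withDensity (W.indicator 1 * R)` ⇒ `D` VANISHES A.E. OFF `W`» — the shape in which the chart road's window letter `hlaw` constrains a density. [folklore] -/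
theorem ae_zero_off_of_withDensity_eq_indicator_mul (μ : Measure Ω) {D R : Ω → ℝ≥0∞} (hD : Measurable D) {W : Set Ω} (hW : MeasurableSet W)
    (h : μ.withDensity D = μ.withDensity fun x => W.indicator (1 : Ω → ℝ≥0∞) x * R x) :
    ∀ᵐ x ∂μ, x ∉ W → D x = 0 := by
  have hWc : (μ.withDensity D) Wᶜ = 0 := by
    rw [h, withDensity_apply _ hW.compl,
      setLIntegral_congr_fun hW.compl (g := fun _ => 0) fun x hx => by rw [indicator_of_notMem hx, zero_mul],
      lintegral_zero]
  rw [withDensity_apply _ hW.compl, lintegral_eq_zero_iff hD] at hWc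
  have h' : ∀ᵐ x ∂μ, x ∈ Wᶜ → D x = (0 : Ω → ℝ≥0∞) x := (ae_restrict_iff' hW.compl).mp hWc
  filter_upwards [h'] with x hx hxW
  exact hx hxW

end Abstract

/-! ## §2 The site move on a product of groups: Haar averaging -/

section SiteMove

open Literature.MathematicalPhysics.QuantumFieldTheory.Balaban1983to89

variable {ι G' : Type*} [Fintype ι] [DecidableEq ι] [GaugeGroup G'] [MeasurableSpace G'] [HaarData G'] [MeasurableMul₂ G'] [MeasurableInv G']

omit [MeasurableInv G'] in
/-- **THE SITE MOVE PRESERVES PRODUCT HAAR.**  For finite sets `O`, `I` of coordinates, the map `y ↦ (i ↦ g·y i on O, y i·g⁻¹ on I ∖ O, y i elsewhere)` (the action on the block bonds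
of the gauge transformation `g` at a site: `O` = its out-bonds, `I` = its in-bonds) preserves `∏ Haar` (`measurePreserving_pi`; `HaarData.map_mul_left ∕ map_mul_right`). [folklore] -/
theorem measurePreserving_siteMove (O I : Finset ι) (g : G') :
    MeasurePreserving (fun (y : ι → G') (i : ι) => (if i ∈ O then (fun u : G' => g * u) else if i ∈ I then (fun u : G' => u * g⁻¹) else id) (y i))
      (Measure.pi fun _ : ι => (HaarData.haar : Measure G')) (Measure.pi fun _ : ι => (HaarData.haar : Measure G')) := by
  refine measurePreserving_pi (fun _ : ι => (HaarData.haar : Measure G')) (fun _ : ι => (HaarData.haar : Measure G')) fun i => ?_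
  by_cases hO : i ∈ O
  · simp only [hO, if_true]
    exact ⟨measurable_const_mul g, HaarData.map_mul_left g⟩
  · by_cases hI : i ∈ I
    · simp only [hO, if_false, hI, if_true]
      exact ⟨measurable_mul_const g⁻¹, HaarData.map_mul_right g⁻¹⟩
    · simp only [hO, hI, if_false]
      exact MeasurePreserving.id _

omit [Fintype ι] [HaarData G'] in
/-- the site move is jointly measurable in `(g, y)`. [folklore] -/
theorem measurable_siteMove_uncurry (O I : Finset ι) :
    Measurable fun p : G' × (ι → G') => fun i : ι =>
      (if i ∈ O then (fun u : G' => p.1 * u) else if i ∈ I then (fun u : G' => u * p.1⁻¹) else id) (p.2 i) := by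
  refine measurable_pi_lambda _ fun i => ?_
  have hyi : Measurable fun p : G' × (ι → G') => p.2 i := (measurable_pi_apply i).comp measurable_snd
  by_cases hO : i ∈ O
  · simp only [hO, if_true]
    exact measurable_fst.mul hyi
  · by_cases hI : i ∈ I
    · simp only [hO, if_false, hI, if_true]
      exact hyi.mul measurable_fst.inv
    · simp only [hO, hI, if_false, id]
      exact hyi

omit [Fintype ι] [MeasurableInv G'] in
/-- **ESCAPE BOUND**: for an out-coordinate `i₀ ∈ O` and a product window `∏ win`, the Haar mass of `{g | move g y ∈ ∏ win}` is at most `Haar (win i₀)` for EVERY `y`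
(the coordinate `i₀` of the moved point is `g·y i₀`, Haar right invariance). [folklore] -/
theorem haar_escape_le (O I : Finset ι) {i₀ : ι} (hi₀ : i₀ ∈ O) (win : ι → Set G') (hwin : ∀ i, MeasurableSet (win i)) (y : ι → G') :
    (HaarData.haar : Measure G') {g | (fun i : ι => (if i ∈ O then (fun u : G' => g * u) else if i ∈ I then (fun u : G' => u * g⁻¹) else id) (y i)) ∈
        Set.pi univ win} ≤ (HaarData.haar : Measure G') (win i₀) := by
  have hsub : {g : G' | (fun i : ι => (if i ∈ O then (fun u : G' => g * u) else if i ∈ I then (fun u : G' => u * g⁻¹) else id) (y i)) ∈ Set.pi univ win}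
      ⊆ (fun g : G' => g * y i₀) ⁻¹' (win i₀) := by
    intro g hg
    have h := hg i₀ (mem_univ _)
    simp only [hi₀, if_true] at h
    exact h
  calc (HaarData.haar : Measure G') _ ≤ (HaarData.haar : Measure G') ((fun g : G' => g * y i₀) ⁻¹' (win i₀)) := measure_mono hsub
    _ = ((HaarData.haar : Measure G').map (fun g : G' => g * y i₀)) (win i₀) := (Measure.map_apply (measurable_mul_const (y i₀)) (hwin i₀)).symm
    _ = (HaarData.haar : Measure G') (win i₀) := by rw [HaarData.map_mul_right (y i₀)]

/-- ★★ **A SITE-INVARIANT DENSITY CARRIED BY A PRODUCT WINDOW VANISHES** when one out-coordinate's window has Haar mass `< 1`: `D` measurable on `ι → G'`, invariant under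
the site move of every `g`, `D = 0` a.e. off `∏ win` ⟹ `D = 0` a.e. for `∏ Haar`. [folklore] -/
theorem pi_density_ae_zero_of_siteInvariant_of_window (O I : Finset ι) {i₀ : ι} (hi₀ : i₀ ∈ O) (win : ι → Set G') (hwin : ∀ i, MeasurableSet (win i))
    (hq : (HaarData.haar : Measure G') (win i₀) < 1) {D : (ι → G') → ℝ≥0∞} (hD : Measurable D)
    (hinv : ∀ (g : G') (y : ι → G'), D (fun i : ι => (if i ∈ O then (fun u : G' => g * u) else if i ∈ I then (fun u : G' => u * g⁻¹) else id) (y i)) = D y)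
    (hDW : ∀ᵐ y ∂(Measure.pi fun _ : ι => (HaarData.haar : Measure G')), y ∉ Set.pi univ win → D y = 0) :
    D =ᵐ[Measure.pi fun _ : ι => (HaarData.haar : Measure G')] 0 :=
  density_ae_zero_of_invariant_of_window (Measure.pi fun _ : ι => (HaarData.haar : Measure G')) (HaarData.haar : Measure G')
    (fun (g : G') (y : ι → G') (i : ι) => (if i ∈ O then (fun u : G' => g * u) else if i ∈ I then (fun u : G' => u * g⁻¹) else id) (y i))
    (measurable_siteMove_uncurry O I) (measurePreserving_siteMove O I) hD hinv (MeasurableSet.univ_pi hwin) hDW hq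
    (fun y => haar_escape_le O I hi₀ win hwin y) (measure_ne_top _ _)

end SiteMove

/-! ## §3 At dag-n21-d's block fibre law of record: the window letter + site invariance ⇒ the zero law -/

section AtRecord

open Literature.MathematicalPhysics.QuantumFieldTheory.Balaban1983to89
open Literature.MathematicalPhysics.QuantumFieldTheory.Balaban1983to89.T4Continuum
open Literature.MathematicalPhysics.QuantumFieldTheory.Balaban1983to89.Node00 hiding dimSU
open T4ShellMeasure (SlotAntiConcentration)
open T4ShellMeasureDet (blockLaw blockLaw_eq_pi)
open N21ShellSplitOfRecord13CoPH (cubeDensityOfDatum₉ blockFibreLawOfDatum₉ measurable_cubeDensityOfDatum₉)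
open Summit.QuantumFields.BalabanUV.T4Continuum.ShellMeasureExpChartSUN (SUN)
open Summit.QuantumFields.BalabanUV.T4Continuum.ShellMeasureScalingSUN (windowSU expWindowSU measurableSet_expWindowSU windowSU_eq_indicator)

variable (F : T4Family) (N : ℕ) [NeZero N] (ϑ : Stage9Params F N) (Dt : FiniteEpsData F (SU N)) (g₀ : ℕ → ℝ)
  (os : List (ULoop F)) (p : B12.RunParams) (g : ℕ → ℝ) (k : ℕ)

/-- (M1) for the ZERO measure, every `u θ ρ D` — the junk inhabitation, said plainly. [folklore] -/
theorem slotAntiConcentration_of_measure_eq_zero {Ω : Type*} [MeasurableSpace Ω] {μ : Measure Ω} (hμ : μ = 0) (u : Ω → ℝ) (θ ρ D : ℝ) :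
    SlotAntiConcentration μ u θ ρ D := by
  subst hμ
  simp [SlotAntiConcentration]

/-- ★★ **THE WINDOW LETTER AND SITE INVARIANCE FORCE THE ZERO FIBRE LAW.**  One truncated-law fibre (source `t`, top cube `a`, block `b`, exterior `x`) with (H-U), (H-ζ) and the
datum's averaging measurability (for the density's measurability): IF the window factorisation `hlaw` holds about some centre `c` with radius `S` and weight `R`, the block carries
the out-bonds `O ≠ ∅` and in-bonds `I` of a site under whose gauge move the fibre density `y ↦ cubeDensityOfDatum₉ … (x ⊕ y)` is INVARIANT (the printed gauge invariance, as a
hypothesis), and ONE out-bond's window `c b₀ · exp(B̄_S)` has Haar mass `< 1` (folklore for `S ≤ π`, as a hypothesis), THEN `blockFibreLawOfDatum₉ … t a b x = 0`. [folklore] -/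
theorem blockFibreLawOfDatum₉_eq_zero_of_window_of_siteInvariant
    (hU : LocalBgMeasurable F N ϑ.ν) (hζm : ZetaMeasurable F N ϑ.ζ) (hD : Dt.AvgMeasurable) (t : ℝ)
    (a : ↥(cubeIndices (F.P p.K) (cubeSide (F.P p.K).L ϑ.ν.M₂ (RkOfRecord (F.P p.K).L ϑ.ν.r (g k)) k)))
    (b : Finset (PBond (F.P p.K) k)) (x : GaugeField (F.P p.K) k (SU N))
    (S : ℝ) (c : GaugeField (F.P p.K) k (SU N)) (R : (↥b → SU N) → ℝ≥0∞)
    (hlaw : blockFibreLawOfDatum₉ F N ϑ Dt g₀ os p g k t a b x = (blockLaw b).withDensity fun y => windowSU b c S y * R y)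
    (O I : Finset ↥b) {b₀ : ↥b} (hb₀ : b₀ ∈ O)
    (hinv : ∀ (h : SU N) (y : ↥b → SU N), letI := Classical.decEq (PBond (F.P p.K) k)
      cubeDensityOfDatum₉ F N ϑ Dt g₀ os p g k t a
          (Function.updateFinset x b fun i : ↥b => (if i ∈ O then (fun u : SU N => h * u) else if i ∈ I then (fun u : SU N => u * h⁻¹) else id) (y i)) =
        cubeDensityOfDatum₉ F N ϑ Dt g₀ os p g k t a (Function.updateFinset x b y))
    (hq : (HaarData.haar : Measure (SU N)) (expWindowSU (c b₀) S) < 1) :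
    blockFibreLawOfDatum₉ F N ϑ Dt g₀ os p g k t a b x = 0 := by
  letI := Classical.decEq (PBond (F.P p.K) k)
  -- the density and its measurability
  have hDm : Measurable fun y : ↥b → SU N => cubeDensityOfDatum₉ F N ϑ Dt g₀ os p g k t a (Function.updateFinset x b y) :=
    (measurable_cubeDensityOfDatum₉ F N ϑ Dt g₀ os p g k hU hζm hD t a).comp measurable_updateFinset
  -- the fibre law unfolded (definitional, at the definition's own `Classical.decEq`)
  have hdef : blockFibreLawOfDatum₉ F N ϑ Dt g₀ os p g k t a b x =
      (Measure.pi fun _ : ↥b => (HaarData.haar : Measure (SU N))).withDensity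
        fun y => cubeDensityOfDatum₉ F N ϑ Dt g₀ os p g k t a (Function.updateFinset x b y) := rfl
  -- the window as a product set
  have hwin : ∀ i : ↥b, MeasurableSet (expWindowSU (c i) S) := fun i => measurableSet_expWindowSU (c i) S
  have hW : (fun y : ↥b → SU N => windowSU b c S y * R y) = fun y => (Set.pi univ fun i : ↥b => expWindowSU (c i) S).indicator (1 : (↥b → SU N) → ℝ≥0∞) y * R y := by
    funext y
    rw [windowSU_eq_indicator]
  -- D vanishes a.e. off the window
  have hDW : ∀ᵐ y ∂(Measure.pi fun _ : ↥b => (HaarData.haar : Measure (SU N))), y ∉ (Set.pi univ fun i : ↥b => expWindowSU (c i) S) →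
      cubeDensityOfDatum₉ F N ϑ Dt g₀ os p g k t a (Function.updateFinset x b y) = 0 := by
    refine ae_zero_off_of_withDensity_eq_indicator_mul _ (R := R) hDm (MeasurableSet.univ_pi hwin) ?_
    rw [← hdef, hlaw, blockLaw_eq_pi, hW]
  have hae := pi_density_ae_zero_of_siteInvariant_of_window O I hb₀ (fun i : ↥b => expWindowSU (c i) S) hwin hq hDm
    (fun h y => hinv h y) hDW
  rw [hdef, withDensity_congr_ae hae, withDensity_zero]

/-- COROLLARY: under the same letters (M1) for the block fibre law holds for EVERY statistic and EVERY `θ ρ D` — only as the junk instance. [folklore] -/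
theorem slotAntiConcentration_blockFibreLaw_of_window_of_siteInvariant
    (hU : LocalBgMeasurable F N ϑ.ν) (hζm : ZetaMeasurable F N ϑ.ζ) (hD : Dt.AvgMeasurable) (t : ℝ)
    (a : ↥(cubeIndices (F.P p.K) (cubeSide (F.P p.K).L ϑ.ν.M₂ (RkOfRecord (F.P p.K).L ϑ.ν.r (g k)) k)))
    (b : Finset (PBond (F.P p.K) k)) (x : GaugeField (F.P p.K) k (SU N))
    (S : ℝ) (c : GaugeField (F.P p.K) k (SU N)) (R : (↥b → SU N) → ℝ≥0∞)
    (hlaw : blockFibreLawOfDatum₉ F N ϑ Dt g₀ os p g k t a b x = (blockLaw b).withDensity fun y => windowSU b c S y * R y)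
    (O I : Finset ↥b) {b₀ : ↥b} (hb₀ : b₀ ∈ O)
    (hinv : ∀ (h : SU N) (y : ↥b → SU N), letI := Classical.decEq (PBond (F.P p.K) k)
      cubeDensityOfDatum₉ F N ϑ Dt g₀ os p g k t a
          (Function.updateFinset x b fun i : ↥b => (if i ∈ O then (fun u : SU N => h * u) else if i ∈ I then (fun u : SU N => u * h⁻¹) else id) (y i)) =
        cubeDensityOfDatum₉ F N ϑ Dt g₀ os p g k t a (Function.updateFinset x b y))
    (hq : (HaarData.haar : Measure (SU N)) (expWindowSU (c b₀) S) < 1)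
    (u : (↥b → SU N) → ℝ) (θ ρ D : ℝ) :
    SlotAntiConcentration (blockFibreLawOfDatum₉ F N ϑ Dt g₀ os p g k t a b x) u θ ρ D :=
  slotAntiConcentration_of_measure_eq_zero
    (blockFibreLawOfDatum₉_eq_zero_of_window_of_siteInvariant F N ϑ Dt g₀ os p g k hU hζm hD t a b x S c R hlaw O I hb₀ hinv hq) u θ ρ D

end AtRecord

end Summit.QuantumFields.YangMills.Theorems.N21ChartJunctionKeyed

end
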